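import Summits.Parity.BatemanHorn.Theorems.SoloInformedThinPolynomial
import Summits.Parity.BatemanHorn.Theorems.SoloInformedThinSharp
import HarnessLib

/-!
# Thin sequences vs. Type-I/II information, XVIII: polynomial-growth supports, sharp forms

Headline corollaries of the sharp short-interval capstones (`SoloInformedThinSharp`) for supports
of polynomial growth — the values `g(k) ≥ k^d` (`d ≥ 2`), in particular `k² + 1`: for every real
weighting `a` of these values in `(x/2, x]` and every `x^{1−η}/2 ≤ y ≤ x/2`,
`w = a − x/(2y)·1_{(x−y,x]}` violates

* (II) in `[θ, θ + ν]` whenever `θ < 1 − 1/d`, `η < 1 − 1/d`, `θ + η < 1`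
  (`k² + 1`: `θ < 1/2`, `η < 1/2`);
* (I) at level `x^γ` whenever `γ > 1/d`, `0 ≤ η < 1 − 1/d` (`k² + 1`: `γ > 1/2`, `η < 1/2`);
* (I) at level `x^γ`, `γ > 1/d`, for the twisted sequences `(xq/2)/(yφ(q))·1_{x−y<n≤x,(n,q)=1}`
  of [cite: FordMaynard2024PrimeSieves, §4.2 (Lemma 4.6)] whenever `2x^κ q ≤ y`, `κ > 1/d`.

So the full Type-I/II ranges of Ford–Maynard's constructions are void for these supports:
(I) is available only up to the density `x^{1/d}` and (II) only from `x^{1−1/d}` on, against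
every one of their comparison sequences.  References: [cite: FordMaynard2024PrimeSieves, §2.4]
[cite: FordMaynard2024PrimeSieves, §1].
-/

noncomputable section

open Filter Finset Real

namespace Summit.Parity.BatemanHorn.Theorems

open Literature.Barriers.Parity.FordMaynard (TypeI TypeII eventually_mul_rpow_le_rpow)

/-- **Polynomial-growth supports vs. short intervals, Type II — sharp form.**  Let `d ≥ 2`,
`0 ≤ θ < 1 − 1/d`, `η < 1 − 1/d`, `θ + η < 1`, `ν > 0`, `B > 1`.  For all large `x`: if
`g k ≥ k^d` and `a` vanishes on `(x/2, x]` outside the image of `g`, then for every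
`x^{1−η}/2 ≤ y ≤ x/2` the sequence `w = a − x/(2y)·1_{(x−y, x]}` violates (II) in `[θ, θ + ν]`.
[cite: FordMaynard2024PrimeSieves, §2.4] [cite: FordMaynard2024PrimeSieves, §4.2 (Lemma 4.6)] -/
theorem eventually_not_typeII_polyGrowth_shortInterval_sharp {d : ℕ} (hd : 2 ≤ d)
    {θ ν B η : ℝ} (hθ : 0 ≤ θ) (hθd : θ < 1 - 1 / d) (hηd : η < 1 - 1 / d) (hθη : θ + η < 1)
    (hν : 0 < ν) (hB : 1 < B) :
    ∀ᶠ x : ℝ in atTop, ∀ (g : ℕ → ℕ), (∀ k, k ^ d ≤ g k) → ∀ (a : ℕ → ℝ) (y : ℝ),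
      (∀ v : ℕ, x / 2 < (v : ℝ) → (v : ℝ) ≤ x → a v ≠ 0 → ∃ k, g k = v) →
      x ^ (1 - η) / 2 ≤ y → y ≤ x / 2 →
      ¬ TypeII (fun n : ℕ => a n -
        (Set.Ioc (x - y) x).indicator (fun _ : ℝ => x / (2 * y)) (n : ℝ)) x θ ν B := by
  have hd0 : d ≠ 0 := by omega
  have hdr : (2 : ℝ) ≤ d := by exact_mod_cast hd
  have hdpos : (0 : ℝ) < 1 / d := by positivity
  have hm1 : θ ≤ max θ η := le_max_left _ _
  have hm2 : η ≤ max θ η := le_max_right _ _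
  have hmax : max θ η < 1 - 1 / d := max_lt hθd hηd
  set c : ℝ := (max θ η + (1 - 1 / d)) / 2 with hcdef
  have hθc : θ < c := by rw [hcdef]; linarith
  have hηc : η < c := by rw [hcdef]; linarith
  have hc1d : c < 1 - 1 / d := by rw [hcdef]; linarith
  have hc1 : c ≤ 1 := by linarith
  filter_upwards [eventually_not_typeII_shortInterval_sharp hθ hθc hηc hθη hc1 hν hB,
    eventually_mul_rpow_le_rpow 2 (by linarith : 1 / (d : ℝ) < 1 - c),
    eventually_ge_atTop (1 : ℝ)] with x hx e1 hx1 g hg a y ha hy1 hy2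
  obtain ⟨A, hA, hcov⟩ := exists_cover_of_polyGrowth hd0 hg (by linarith) ha
  have hx1d : 1 ≤ x ^ (1 / d : ℝ) := Real.one_le_rpow hx1 hdpos.le
  exact hx a A y (by linarith) hcov hy1 hy2

/-- **Polynomial-growth supports vs. short intervals, Type I — sharp form.**  Let `d ≥ 2`,
`0 ≤ η < 1 − 1/d`, `γ > 1/d`, `B > 1`.  For all large `x`: if `g k ≥ k^d` and `a` vanishes on
`(x/2, x]` outside the image of `g`, then for every `x^{1−η}/2 ≤ y ≤ x/2` the sequence
`w = a − x/(2y)·1_{(x−y, x]}` violates (I) at level `x^γ`.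
[cite: FordMaynard2024PrimeSieves, §2.4] [cite: FordMaynard2024PrimeSieves, §4.2 (Lemma 4.6)] -/
theorem eventually_not_typeI_polyGrowth_shortInterval_sharp {d : ℕ} (hd : 2 ≤ d) {γ B η : ℝ}
    (hη : 0 ≤ η) (hηd : η < 1 - 1 / d) (hγ : 1 / d < γ) (hB : 1 < B) :
    ∀ᶠ x : ℝ in atTop, ∀ (g : ℕ → ℕ), (∀ k, k ^ d ≤ g k) → ∀ (a : ℕ → ℝ) (y : ℝ),
      (∀ v : ℕ, x / 2 < (v : ℝ) → (v : ℝ) ≤ x → a v ≠ 0 → ∃ k, g k = v) →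
      x ^ (1 - η) / 2 ≤ y → y ≤ x / 2 →
      ¬ TypeI (fun n : ℕ => a n -
        (Set.Ioc (x - y) x).indicator (fun _ : ℝ => x / (2 * y)) (n : ℝ)) x γ B := by
  have hd0 : d ≠ 0 := by omega
  have hdr : (2 : ℝ) ≤ d := by exact_mod_cast hd
  have hdpos : (0 : ℝ) < 1 / d := by positivity
  have hm1 : 1 - γ ≤ max (1 - γ) η := le_max_left _ _
  have hm2 : η ≤ max (1 - γ) η := le_max_right _ _
  have hmax : max (1 - γ) η < 1 - 1 / d := max_lt (by linarith) hηd
  set c : ℝ := (max (1 - γ) η + (1 - 1 / d)) / 2 with hcdef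
  have hγc : 1 - c < γ := by rw [hcdef]; linarith
  have hηc : η < c := by rw [hcdef]; linarith
  have hc1d : c < 1 - 1 / d := by rw [hcdef]; linarith
  have hc1 : c ≤ 1 := by linarith
  filter_upwards [eventually_not_typeI_shortInterval_sharp hη hηc hc1 hγc hB,
    eventually_mul_rpow_le_rpow 2 (by linarith : 1 / (d : ℝ) < 1 - c),
    eventually_ge_atTop (1 : ℝ)] with x hx e1 hx1 g hg a y ha hy1 hy2
  obtain ⟨A, hA, hcov⟩ := exists_cover_of_polyGrowth hd0 hg (by linarith) ha
  have hx1d : 1 ≤ x ^ (1 / d : ℝ) := Real.one_le_rpow hx1 hdpos.le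
  exact hx a A y (by linarith) hcov hy1 hy2

/-- **`n² + 1` vs. short intervals, Type II — sharp form**: no weighting `a` of the numbers
`k² + 1` in `(x/2, x]` makes `a − x/(2y)·1_{(x−y, x]}` satisfy (II) in a window `[θ, θ + ν]`
with `θ < 1/2`, for any `x^{1−η}/2 ≤ y ≤ x/2` with `η < 1/2` (`x` large).
[cite: FordMaynard2024PrimeSieves, §2.4] -/
theorem eventually_not_typeII_sq_add_one_shortInterval_sharp {θ ν B η : ℝ} (hθ : 0 ≤ θ)
    (hθ2 : θ < 1 / 2) (hη2 : η < 1 / 2) (hν : 0 < ν) (hB : 1 < B) :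
    ∀ᶠ x : ℝ in atTop, ∀ (a : ℕ → ℝ) (y : ℝ),
      (∀ v : ℕ, x / 2 < (v : ℝ) → (v : ℝ) ≤ x → a v ≠ 0 → ∃ k, k ^ 2 + 1 = v) →
      x ^ (1 - η) / 2 ≤ y → y ≤ x / 2 →
      ¬ TypeII (fun n : ℕ => a n -
        (Set.Ioc (x - y) x).indicator (fun _ : ℝ => x / (2 * y)) (n : ℝ)) x θ ν B := by
  have h1 : θ < 1 - 1 / ((2 : ℕ) : ℝ) := by push_cast; linarith
  have h2 : η < 1 - 1 / ((2 : ℕ) : ℝ) := by push_cast; linarith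
  filter_upwards [eventually_not_typeII_polyGrowth_shortInterval_sharp (le_refl 2) hθ h1 h2
    (by linarith) hν hB] with x hx a y ha
  exact hx (fun k => k ^ 2 + 1) (fun k => Nat.le_succ _) a y ha

/-- **`n² + 1` vs. short intervals, Type I — sharp form**: … nor (I) at any level `γ > 1/2`,
for any `x^{1−η}/2 ≤ y ≤ x/2` with `0 ≤ η < 1/2`. [cite: FordMaynard2024PrimeSieves, §2.4] -/
theorem eventually_not_typeI_sq_add_one_shortInterval_sharp {γ B η : ℝ} (hη : 0 ≤ η)
    (hη2 : η < 1 / 2) (hγ : 1 / 2 < γ) (hB : 1 < B) :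
    ∀ᶠ x : ℝ in atTop, ∀ (a : ℕ → ℝ) (y : ℝ),
      (∀ v : ℕ, x / 2 < (v : ℝ) → (v : ℝ) ≤ x → a v ≠ 0 → ∃ k, k ^ 2 + 1 = v) →
      x ^ (1 - η) / 2 ≤ y → y ≤ x / 2 →
      ¬ TypeI (fun n : ℕ => a n -
        (Set.Ioc (x - y) x).indicator (fun _ : ℝ => x / (2 * y)) (n : ℝ)) x γ B := by
  have h1 : η < 1 - 1 / ((2 : ℕ) : ℝ) := by push_cast; linarith
  have h2 : 1 / ((2 : ℕ) : ℝ) < γ := by push_cast; linarith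
  filter_upwards [eventually_not_typeI_polyGrowth_shortInterval_sharp (le_refl 2) hη h1 h2 hB]
    with x hx a y ha
  exact hx (fun k => k ^ 2 + 1) (fun k => Nat.le_succ _) a y ha

/-- **Polynomial-growth supports vs. the twisted short-interval sequences, Type I — no height
condition.**  Let `d ≥ 2`, `γ > 1/d`, `κ > 1/d`, `B > 1`.  For all large `x`: if `g k ≥ k^d` and
`a` vanishes on `(x/2, x]` outside the image of `g`, then for every `q ≥ 1` and `y ≤ x/2` with
`2 x^κ q ≤ y`, `w = a − (xq/2)/(yφ(q))·1_{x−y<n≤x,(n,q)=1}` violates (I) at level `x^γ`.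
[cite: FordMaynard2024PrimeSieves, §4.2 (Lemma 4.6)] -/
theorem eventually_not_typeI_polyGrowth_shortInterval_coprime_sharp {d : ℕ} (hd : 2 ≤ d)
    {γ B κ : ℝ} (hγ : 1 / d < γ) (hB : 1 < B) (hκ : 1 / d < κ) :
    ∀ᶠ x : ℝ in atTop, ∀ (g : ℕ → ℕ), (∀ k, k ^ d ≤ g k) → ∀ (a : ℕ → ℝ) (y : ℝ) (q : ℕ),
      (∀ v : ℕ, x / 2 < (v : ℝ) → (v : ℝ) ≤ x → a v ≠ 0 → ∃ k, g k = v) → 0 < q →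
      2 * x ^ κ * q ≤ y → y ≤ x / 2 →
      ¬ TypeI (fun n : ℕ => a n - (if x - y < (n : ℝ) ∧ (n : ℝ) ≤ x ∧ Nat.Coprime n q
        then x * q / (2 * y * (q.totient : ℝ)) else 0)) x γ B := by
  have hd0 : d ≠ 0 := by omega
  have hdr : (2 : ℝ) ≤ d := by exact_mod_cast hd
  have hdpos : (0 : ℝ) < 1 / d := by positivity
  have hd1 : 1 / (d : ℝ) ≤ 1 / 2 := by
    rw [div_le_div_iff₀ (by positivity) (by norm_num)]; linarith
  have hm1 : 1 - γ ≤ max (max (1 - γ) (1 - κ)) 0 := (le_max_left _ _).trans (le_max_left _ _)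
  have hm2 : 1 - κ ≤ max (max (1 - γ) (1 - κ)) 0 :=
    (le_max_right _ _).trans (le_max_left _ _)
  have hm3 : 0 ≤ max (max (1 - γ) (1 - κ)) 0 := le_max_right _ _
  have hmax : max (max (1 - γ) (1 - κ)) 0 < 1 - 1 / d :=
    max_lt (max_lt (by linarith) (by linarith)) (by linarith)
  set c : ℝ := (max (max (1 - γ) (1 - κ)) 0 + (1 - 1 / d)) / 2 with hcdef
  have hc0 : 0 < c := by rw [hcdef]; linarith
  have hγc : 1 - c < γ := by rw [hcdef]; linarith
  have hκc : 1 - c < κ := by rw [hcdef]; linarith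
  have hc1d : c < 1 - 1 / d := by rw [hcdef]; linarith
  have hc1 : c ≤ 1 := by linarith
  filter_upwards [eventually_not_typeI_shortInterval_coprime_sharp hc0 hc1 hγc hB hκc,
    eventually_mul_rpow_le_rpow 2 (by linarith : 1 / (d : ℝ) < 1 - c),
    eventually_ge_atTop (1 : ℝ)] with x hx e1 hx1 g hg a y q ha hq hqy hyx
  obtain ⟨A, hA, hcov⟩ := exists_cover_of_polyGrowth hd0 hg (by linarith) ha
  have hx1d : 1 ≤ x ^ (1 / d : ℝ) := Real.one_le_rpow hx1 hdpos.le
  exact hx a A y q (by linarith) hcov hq hqy hyx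

/-- **`n² + 1` vs. the twisted short-interval sequences, Type I**: for `γ > 1/2`, `κ > 1/2`,
`q ≥ 1`, `2 x^κ q ≤ y ≤ x/2`, no weighting of the `k² + 1` in `(x/2, x]` makes
`a − (xq/2)/(yφ(q))·1_{x−y<n≤x,(n,q)=1}` satisfy (I) at level `x^γ` (`x` large).
[cite: FordMaynard2024PrimeSieves, §4.2 (Lemma 4.6)] -/
theorem eventually_not_typeI_sq_add_one_shortInterval_coprime_sharp {γ B κ : ℝ}
    (hγ : 1 / 2 < γ) (hB : 1 < B) (hκ : 1 / 2 < κ) :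
    ∀ᶠ x : ℝ in atTop, ∀ (a : ℕ → ℝ) (y : ℝ) (q : ℕ),
      (∀ v : ℕ, x / 2 < (v : ℝ) → (v : ℝ) ≤ x → a v ≠ 0 → ∃ k, k ^ 2 + 1 = v) → 0 < q →
      2 * x ^ κ * q ≤ y → y ≤ x / 2 →
      ¬ TypeI (fun n : ℕ => a n - (if x - y < (n : ℝ) ∧ (n : ℝ) ≤ x ∧ Nat.Coprime n q
        then x * q / (2 * y * (q.totient : ℝ)) else 0)) x γ B := by
  have h1 : 1 / ((2 : ℕ) : ℝ) < γ := by push_cast; linarith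
  have h2 : 1 / ((2 : ℕ) : ℝ) < κ := by push_cast; linarith
  filter_upwards [eventually_not_typeI_polyGrowth_shortInterval_coprime_sharp (le_refl 2) h1
    hB h2] with x hx a y q ha
  exact hx (fun k => k ^ 2 + 1) (fun k => Nat.le_succ _) a y q ha

end Summit.Parity.BatemanHorn.Theorems

end
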